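import Summits.Ventures.CertifiedManyBodySolver.Downfold.EmeryScaleEdgeChainL
import Summits.Ventures.CertifiedManyBodySolver.Downfold.EmeryScaleEdgeAssembly
import HarnessLib

/-!
# THE TELESCOPED-EDGE / SCALING-RAY BOX RULE WITH LIPSCHITZ TRANSPORT AND PER-CELL STEP RANGES: `L ≤ t_node(θ; ε_F(θ; ν)) ≤ U` for EVERY member of a
# typed thin-`t_pp′` three-band box — no `Δ`-monotonicity, no `t_pd` lever, no nesting certificate along the ray (INFL-3to1-B §B.91 (d′))

Venture CertifiedManyBodySolver, cell `pub/hubbard-downfold` (stage S1; INFLATION-RULES-3to1-B §B.91), seat hubbard-downfold-mod-4 (technique B = band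
level, g40); namespace `Summit.Ventures.CertifiedManyBodySolver.Downfold.Emery`. Everything PROVED (0 sorry). WHAT THIS IS NOT: a statement about any
material; no number lives here; `U = 0` one-body kinematics of the σ model.

THE DEVICE (variant of `EmeryScaleEdgeBox` over `EmeryScaleEdgeChainL`). UPPER: a member `θ = (Δ, a, b, c)` is `μ⁻¹·(μΔ, a₂, μb, μc)`, `μ = a₂/a`, and
`T(θ) = T(μθ)/μ` (`scaleT_fixedFilling_smul`); the scaled point lies on the oxygen-hopping ray from `(μΔ, a₂, b, c)` at step `s = μ − 1`, which on the
`Δ′`-cell `[Δl, Δr]` of the extended ceiling edge is CONFINED to `s ∈ [Δl/Δ₂ − 1, Δr/Δ₁ − 1] ∩ [0, a₂/a₁ − 1]` (since `Δ′ = μΔ` with `Δ ∈ [Δ₁, Δ₂]`): the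
cells carry their own step ranges `[sLo, sHi]`, checked against these constraints (`sCondL`). LOWER: `μ′ = a₁/a`, `s′ = 1 − μ′ ∈ [1 − Δr/Δ₁, 1 − Δl/Δ₂]`.

* §1 `ECellS` (edge cell + step range), `sCondL`, `edgeBoxCheckL`; assembly lemmas `rayStageCheckL_of_cells`, `edgeCellOKL_true/false_of_parts`,
  `edgeBoxCheckL_of_cells`.
* §2 **`edgeboxL_upper`**, **`edgeboxL_lower`**.

Sources: three-band model [HybertsenSchluterChristensen1989, Eq. (1)]; energy-linearised one-band image [AndersenEtAl1995, §6]; interval arithmetic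
[folklore] (Moore 1966).
-/

noncomputable section

namespace Summit.Ventures.CertifiedManyBodySolver.Downfold.Emery

open Real Set Literature.Analysis.ValidatedNumerics.Numerics

/-! ## §1 Data, tests, assembly -/

/-- An edge cell with its step range `[sLo, sHi]` (scaled integers). [folklore] -/
structure ECellS where
  /-- the edge cell -/
  cell : ECell
  /-- lower end of the ray step range -/
  sLo : ℤ
  /-- upper end of the ray step range -/
  sHi : ℤ

/-- The step-range conditions of a cell: `sHi` covers every relevant step (global range `sRg` or the `Δ′`-confinement) and `sLo` excludes none. [folklore] -/
def sCondL (upper : Bool) (sRg : ℤ) (ID1 ID2 : FI) (x : ECellS) : Bool :=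
  if upper then
    (decide (sRg ≤ x.sHi) || decide (x.cell.iD.hi * (SC : ℤ) ≤ (x.sHi + SC) * ID1.lo)) &&
    (decide (x.sLo ≤ 0) || decide ((x.sLo + SC) * ID2.hi ≤ x.cell.iD.lo * (SC : ℤ)))
  else
    (decide (sRg ≤ x.sHi) || decide ((ID2.hi - x.cell.iD.lo) * (SC : ℤ) ≤ x.sHi * ID2.hi)) &&
    (decide (x.sLo ≤ 0) || decide ((SC : ℤ) * x.cell.iD.hi ≤ ((SC : ℤ) - x.sLo) * ID1.lo))

/-- **`edgeBoxCheckL`**: sign guards on the reference enclosures, the cells cover `[Dlo, Dhi]`, each passes `edgeCellOKL` on its own step range and the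
step-range conditions. [folklore] -/
def edgeBoxCheckL (upper : Bool) (IC IA IB : FI) (wB V whlo sRg : ℤ) (ID1 ID2 : FI) (Dlo Dhi : ℤ) (cells : List ECellS) : Bool :=
  decide (0 < ID1.lo) && decide (0 < ID2.hi) && coversBy (fun x : ECellS => x.cell.iD) Dlo Dhi cells &&
  cells.all (fun x => edgeCellOKL upper IC IA IB wB x.sLo x.sHi V whlo x.cell && sCondL upper sRg ID1 ID2 x)

/-- A ray stage check from its cells. [folklore] -/
theorem rayStageCheckL_of_cells {upper : Bool} {IC famD IA famB W : FI} {sLo sHi : ℤ} {rays : List RCell}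
    (hcov : coversBy RCell.iS sLo sHi rays = true) (hall : ∀ rc ∈ rays, rayCellOKL upper IC famD IA famB W rc = true) :
    rayStageCheckL upper IC famD IA famB W sLo sHi rays = true := by
  unfold rayStageCheckL
  rw [Bool.and_eq_true, List.all_eq_true]
  exact ⟨hcov, hall⟩

/-- An UPPER edge cell check from its parts. [folklore] -/
theorem edgeCellOKL_true_of_parts {IC IA IB : FI} {wB sLo sHi V whlo : ℤ} {ec : ECell}
    (hval : valueCheck true IC V ec.nv ⟨ec.iD, IA, IB, thin 0, thin ec.W.lo⟩ = true) (hsc : edgeScalars IC IA IB ec = true)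
    (hstage : stageCheck true (thin 0) (thin 0) (thin (-(SC : ℤ))) IC IC whlo ec.iD IA IB ec.W wB (ec.bnodes.map (·.cell)) = true)
    (hrays : ∀ nb ∈ ec.bnodes, rayStageCheckL true IC ec.iD IA (famOf IB nb.cell.iS (thin (-(SC : ℤ)))) nb.cell.Wout sLo sHi nb.rays = true) :
    edgeCellOKL true IC IA IB wB sLo sHi V whlo ec = true := by
  unfold edgeCellOKL
  unfold edgeScalars at hsc
  simp only [Bool.and_eq_true, ↓reduceIte] at hsc ⊢
  obtain ⟨⟨⟨⟨⟨⟨h1, h2⟩, h3⟩, h4⟩, h5⟩, h6⟩, h7⟩ := hsc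
  exact ⟨⟨⟨⟨⟨⟨⟨⟨⟨hval, h1⟩, h2⟩, h3⟩, h4⟩, h5⟩, h6⟩, h7⟩, hstage⟩, List.all_eq_true.2 hrays⟩

/-- A LOWER edge cell check from its parts. [folklore] -/
theorem edgeCellOKL_false_of_parts {IC IA IB : FI} {wB sLo sHi V whlo : ℤ} {ec : ECell}
    (hval : valueCheck false IC V ec.nv ⟨ec.iD, IA, IB, thin 0, thin ec.W.hi⟩ = true) (hsc : edgeScalars IC IA IB ec = true)
    (hstage : stageCheck false (thin 0) (thin 0) (thin (SC : ℤ)) IC IC whlo ec.iD IA IB ec.W wB (ec.bnodes.map (·.cell)) = true)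
    (hrays : ∀ nb ∈ ec.bnodes, rayStageCheckL false IC ec.iD IA (famOf IB nb.cell.iS (thin (SC : ℤ))) nb.cell.Wout sLo sHi nb.rays = true) :
    edgeCellOKL false IC IA IB wB sLo sHi V whlo ec = true := by
  unfold edgeCellOKL
  unfold edgeScalars at hsc
  simp only [Bool.and_eq_true, Bool.false_eq_true, ↓reduceIte] at hsc ⊢
  obtain ⟨⟨⟨⟨⟨⟨h1, h2⟩, h3⟩, h4⟩, h5⟩, h6⟩, h7⟩ := hsc
  exact ⟨⟨⟨⟨⟨⟨⟨⟨⟨hval, h1⟩, h2⟩, h3⟩, h4⟩, h5⟩, h6⟩, h7⟩, hstage⟩, List.all_eq_true.2 hrays⟩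

/-- The box check from its cells. [folklore] -/
theorem edgeBoxCheckL_of_cells {upper : Bool} {IC IA IB : FI} {wB V whlo sRg : ℤ} {ID1 ID2 : FI} {Dlo Dhi : ℤ} {cells : List ECellS}
    (h1 : 0 < ID1.lo) (h2 : 0 < ID2.hi) (hcov : coversBy (fun x : ECellS => x.cell.iD) Dlo Dhi cells = true)
    (hall : ∀ x ∈ cells, edgeCellOKL upper IC IA IB wB x.sLo x.sHi V whlo x.cell = true ∧ sCondL upper sRg ID1 ID2 x = true) :
    edgeBoxCheckL upper IC IA IB wB V whlo sRg ID1 ID2 Dlo Dhi cells = true := by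
  unfold edgeBoxCheckL
  simp only [Bool.and_eq_true, decide_eq_true_eq, List.all_eq_true]
  exact ⟨⟨⟨h1, h2⟩, hcov⟩, hall⟩

/-! ## §2 The box rule -/

section Box

variable {IC IA IB ID1 ID2 : FI} {wB V whlo sRg Dlo Dhi : ℤ} {cells : List ECellS} {Δ₁ Δ₂ a₁ a₂ b₁ b₂ c ν : ℝ}

/-- **THE UPPER BOX RULE (telescoped ceiling edge + scaling ray, Lipschitz transport).** For every member `(Δ, a, b, c)` of
`[Δ₁, Δ₂] × [a₁, a₂] × [b₁, b₂] × {c}`: **`T(Δ, a, b, c; ν) ≤ V/SC`**, given the kernel check, the edge windows of every cell for the edge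
`(·, a₂, b₂, c)`, the `t_pp`-member floor at `((a₂/a₁)Δ₂, a₂, b₁, c)`, and the corner arithmetic. [folklore] -/
theorem edgeboxL_upper (h : edgeBoxCheckL true IC IA IB wB V whlo sRg ID1 ID2 Dlo Dhi cells = true) (hC : FI.mem c IC) (hA2 : FI.mem a₂ IA)
    (hB2 : FI.mem b₂ IB) (hD1 : FI.mem Δ₁ ID1) (hD2 : FI.mem Δ₂ ID2) (hν0 : 0 < ν) (hν1 : ν < 1) (hΔ₁ : 0 < Δ₁) (ha₁ : 0 < a₁) (hb₁ : 0 ≤ b₁)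
    (hc0 : 0 ≤ c) (hDlo : (Dlo : ℝ) ≤ Δ₁ * SC) (hDhi : a₂ / a₁ * Δ₂ * SC ≤ (Dhi : ℝ)) (hwB : (b₂ - b₁) * SC ≤ (wB : ℝ))
    (hsR : (a₂ / a₁ - 1) * SC ≤ (sRg : ℝ))
    (hWs : ∀ x ∈ cells, ∀ Δ' : ℝ, FI.mem Δ' x.cell.iD → FI.mem (fermiEnergyOf Δ' a₂ b₂ c ν) x.cell.W)
    (hfloor : (whlo : ℝ) / SC ≤ fermiEnergyOf (a₂ / a₁ * Δ₂) a₂ b₁ c ν)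
    {Δ a b : ℝ} (hΔ : Δ ∈ Icc Δ₁ Δ₂) (ha : a ∈ Icc a₁ a₂) (hb : b ∈ Icc b₁ b₂) :
    scaleNodeN Δ a b c (fermiEnergyOf Δ a b c ν) / scaleNodeD Δ a b c (fermiEnergyOf Δ a b c ν) ≤ (V : ℝ) / SC := by
  unfold edgeBoxCheckL at h
  simp only [Bool.and_eq_true, decide_eq_true_eq] at h
  obtain ⟨⟨⟨hI1, hI2⟩, hcov⟩, hall⟩ := h
  have ha0 : 0 < a := lt_of_lt_of_le ha₁ ha.1
  have hΔ0 : 0 < Δ := lt_of_lt_of_le hΔ₁ hΔ.1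
  have ha₂ : 0 < a₂ := lt_of_lt_of_le ha0 ha.2
  set μ : ℝ := a₂ / a with hμ
  have hμ0 : 0 < μ := div_pos ha₂ ha0
  have hμ1 : 1 ≤ μ := by rw [hμ, one_le_div ha0]; exact ha.2
  have hμtop : μ ≤ a₂ / a₁ := div_le_div_of_nonneg_left ha₂.le ha₁ ha.1
  set s : ℝ := μ - 1 with hs
  have hs0 : 0 ≤ s := by rw [hs]; linarith
  set Δ' : ℝ := μ * Δ with hΔ'
  have hΔΔ' : Δ ≤ Δ' := by
    rw [hΔ']; have : 0 ≤ (μ - 1) * Δ := mul_nonneg (by linarith) hΔ0.le; linarith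
  have hD1m : (Dlo : ℝ) ≤ Δ' * SC := hDlo.trans (mul_le_mul_of_nonneg_right (hΔ.1.trans hΔΔ') SC_pos.le)
  have hDtop : Δ' ≤ a₂ / a₁ * Δ₂ := by rw [hΔ']; exact mul_le_mul hμtop hΔ.2 hΔ0.le (by positivity)
  have hD2m : Δ' * SC ≤ (Dhi : ℝ) := (mul_le_mul_of_nonneg_right hDtop SC_pos.le).trans hDhi
  obtain ⟨x, hx, hDm⟩ := exists_of_coversBy (fun x : ECellS => x.cell.iD) cells Dlo Dhi hcov Δ' hD1m hD2m
  have hokx := List.all_eq_true.1 hall x hx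
  rw [Bool.and_eq_true] at hokx
  obtain ⟨hok, hsc⟩ := hokx
  have hW := hWs x hx Δ' hDm
  have hΔ'0 : 0 < Δ' := mul_pos hμ0 hΔ0
  have hb2' : (b₂ - b) * SC ≤ (wB : ℝ) := (mul_le_mul_of_nonneg_right (by linarith [hb.1]) SC_pos.le).trans hwB
  -- the step range of the cell contains s
  unfold sCondL at hsc
  simp only [↓reduceIte, Bool.and_eq_true, Bool.or_eq_true, decide_eq_true_eq] at hsc
  obtain ⟨hscHi, hscLo⟩ := hsc
  have hI1r : (0 : ℝ) < (ID1.lo : ℝ) := by exact_mod_cast hI1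
  have hI2r : (0 : ℝ) < (ID2.hi : ℝ) := by exact_mod_cast hI2
  have hsHi : s * SC ≤ (x.sHi : ℝ) := by
    rcases hscHi with h1 | h1
    · have hsle : s ≤ a₂ / a₁ - 1 := by rw [hs]; linarith
      have h1' : (sRg : ℝ) ≤ x.sHi := by exact_mod_cast h1
      have := mul_le_mul_of_nonneg_right hsle SC_pos.le
      linarith
    · have h1r : (x.cell.iD.hi : ℝ) * SC ≤ ((x.sHi : ℝ) + SC) * ID1.lo := by exact_mod_cast h1
      -- μ·ID1.lo ≤ μ·Δ₁·SC ≤ μ·Δ·SC = Δ′·SC ≤ iD.hi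
      have hμI : μ * (ID1.lo : ℝ) ≤ (x.cell.iD.hi : ℝ) := by
        have t1 : μ * (ID1.lo : ℝ) ≤ μ * (Δ₁ * SC) := mul_le_mul_of_nonneg_left hD1.1 hμ0.le
        have t2 : μ * (Δ₁ * SC) ≤ μ * (Δ * SC) := mul_le_mul_of_nonneg_left (mul_le_mul_of_nonneg_right hΔ.1 SC_pos.le) hμ0.le
        have t3 : μ * (Δ * SC) = Δ' * SC := by rw [hΔ']; ring
        linarith [hDm.2]
      have t4 := mul_le_mul_of_nonneg_right hμI SC_pos.le
      have key : (s * SC) * (ID1.lo : ℝ) ≤ (x.sHi : ℝ) * ID1.lo := by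
        have e : (s * SC) * (ID1.lo : ℝ) = μ * (ID1.lo : ℝ) * SC - SC * ID1.lo := by rw [hs]; ring
        have e' : ((x.sHi : ℝ) + SC) * ID1.lo = (x.sHi : ℝ) * ID1.lo + SC * ID1.lo := by ring
        rw [e]; rw [e'] at h1r; linarith
      exact le_of_mul_le_mul_right key hI1r
  have hsLo : (x.sLo : ℝ) ≤ s * SC := by
    rcases hscLo with h1 | h1
    · have h1' : (x.sLo : ℝ) ≤ 0 := by exact_mod_cast h1
      have : 0 ≤ s * SC := mul_nonneg hs0 SC_pos.le
      linarith
    · have h1r : ((x.sLo : ℝ) + SC) * ID2.hi ≤ (x.cell.iD.lo : ℝ) * SC := by exact_mod_cast h1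
      -- iD.lo ≤ Δ′·SC = μΔ·SC ≤ μ·Δ₂·SC ≤ μ·ID2.hi
      have hμI : (x.cell.iD.lo : ℝ) ≤ μ * (ID2.hi : ℝ) := by
        have t1 : (x.cell.iD.lo : ℝ) ≤ Δ' * SC := hDm.1
        have t2 : Δ' * SC ≤ μ * (Δ₂ * SC) := by
          rw [hΔ', mul_assoc]; exact mul_le_mul_of_nonneg_left (mul_le_mul_of_nonneg_right hΔ.2 SC_pos.le) hμ0.le
        have t3 : μ * (Δ₂ * SC) ≤ μ * (ID2.hi : ℝ) := mul_le_mul_of_nonneg_left hD2.2 hμ0.le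
        linarith
      have t4 := mul_le_mul_of_nonneg_right hμI SC_pos.le
      have key : (x.sLo : ℝ) * ID2.hi ≤ (s * SC) * (ID2.hi : ℝ) := by
        have e : (s * SC) * (ID2.hi : ℝ) = μ * (ID2.hi : ℝ) * SC - SC * ID2.hi := by rw [hs]; ring
        have e' : ((x.sLo : ℝ) + SC) * ID2.hi = (x.sLo : ℝ) * ID2.hi + SC * ID2.hi := by ring
        rw [e]; rw [e'] at h1r; linarith
      exact le_of_mul_le_mul_right key hI2r
  -- the t_pp-member floor by monotonicity from the bracketed point
  have hcrude : (whlo : ℝ) / SC ≤ fermiEnergyOf Δ' a₂ b c ν := by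
    refine hfloor.trans ?_
    exact (fermiEnergyOf_mem_Icc_of_mem_box' (Δ := Δ') (a := a₂) (b := b) (c := c) hΔ'0 ha₂ hb₁ hc0 ⟨le_rfl, hDtop⟩ ⟨le_rfl, le_rfl⟩
      ⟨hb.1, le_rfl⟩ ⟨le_rfl, le_rfl⟩ hν0 hν1).1
  have key := edge_cellL_upper hok hC hA2 hB2 hν0 hν1 hDm hW hb.2 hb2' hs0 hsLo hsHi hcrude
  have e0 : a₂ = μ * a := by rw [hμ]; field_simp
  have e1 : b + s * b = μ * b := by rw [hs]; ring
  have e2 : c + s * c = μ * c := by rw [hs]; ring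
  have e3 : 1 + s = μ := by rw [hs]; ring
  rw [e0, e1, e2, e3, hΔ', scaleT_fixedFilling_smul hμ0] at key
  exact le_of_mul_le_mul_left key hμ0

/-- **THE LOWER BOX RULE (telescoped floor edge + scaling ray, Lipschitz transport).** For every member `(Δ, a, b, c)` of
`[Δ₁, Δ₂] × [a₁, a₂] × [b₁, b₂] × {c}`: **`V/SC ≤ T(Δ, a, b, c; ν)`**, given the kernel check, the edge windows of every cell for the edge `(·, a₁, b₁, c)`
and the corner arithmetic. [folklore] -/
theorem edgeboxL_lower (h : edgeBoxCheckL false IC IA IB wB V whlo sRg ID1 ID2 Dlo Dhi cells = true) (hC : FI.mem c IC) (hA1 : FI.mem a₁ IA)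
    (hB1 : FI.mem b₁ IB) (hD1 : FI.mem Δ₁ ID1) (hD2 : FI.mem Δ₂ ID2) (hν0 : 0 < ν) (hν1 : ν < 1) (hΔ₁ : 0 < Δ₁) (ha₁ : 0 < a₁)
    (hDlo : (Dlo : ℝ) ≤ a₁ / a₂ * Δ₁ * SC) (hDhi : Δ₂ * SC ≤ (Dhi : ℝ)) (hwB : (b₂ - b₁) * SC ≤ (wB : ℝ)) (hsR : (1 - a₁ / a₂) * SC ≤ (sRg : ℝ))
    (hWs : ∀ x ∈ cells, ∀ Δ' : ℝ, FI.mem Δ' x.cell.iD → FI.mem (fermiEnergyOf Δ' a₁ b₁ c ν) x.cell.W)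
    {Δ a b : ℝ} (hΔ : Δ ∈ Icc Δ₁ Δ₂) (ha : a ∈ Icc a₁ a₂) (hb : b ∈ Icc b₁ b₂) :
    (V : ℝ) / SC ≤ scaleNodeN Δ a b c (fermiEnergyOf Δ a b c ν) / scaleNodeD Δ a b c (fermiEnergyOf Δ a b c ν) := by
  unfold edgeBoxCheckL at h
  simp only [Bool.and_eq_true, decide_eq_true_eq] at h
  obtain ⟨⟨⟨hI1, hI2⟩, hcov⟩, hall⟩ := h
  have ha0 : 0 < a := lt_of_lt_of_le ha₁ ha.1
  have hΔ0 : 0 < Δ := lt_of_lt_of_le hΔ₁ hΔ.1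
  have ha₂ : 0 < a₂ := lt_of_lt_of_le ha0 ha.2
  set μ : ℝ := a₁ / a with hμ
  have hμ0 : 0 < μ := div_pos ha₁ ha0
  have hμ1 : μ ≤ 1 := by rw [hμ, div_le_one ha0]; exact ha.1
  have hμbot : a₁ / a₂ ≤ μ := div_le_div_of_nonneg_left ha₁.le ha0 ha.2
  set s : ℝ := 1 - μ with hs
  have hs0 : 0 ≤ s := by rw [hs]; linarith
  have hs1 : s ≤ 1 := by rw [hs]; linarith
  set Δ' : ℝ := μ * Δ with hΔ'
  have hD1m : (Dlo : ℝ) ≤ Δ' * SC := by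
    have : a₁ / a₂ * Δ₁ ≤ Δ' := by rw [hΔ']; exact mul_le_mul hμbot hΔ.1 hΔ₁.le hμ0.le
    exact hDlo.trans (mul_le_mul_of_nonneg_right this SC_pos.le)
  have hΔ'Δ : Δ' ≤ Δ := by
    rw [hΔ']; have : 0 ≤ (1 - μ) * Δ := mul_nonneg (by linarith) hΔ0.le; linarith
  have hD2m : Δ' * SC ≤ (Dhi : ℝ) := (mul_le_mul_of_nonneg_right (hΔ'Δ.trans hΔ.2) SC_pos.le).trans hDhi
  obtain ⟨x, hx, hDm⟩ := exists_of_coversBy (fun x : ECellS => x.cell.iD) cells Dlo Dhi hcov Δ' hD1m hD2m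
  have hokx := List.all_eq_true.1 hall x hx
  rw [Bool.and_eq_true] at hokx
  obtain ⟨hok, hsc⟩ := hokx
  have hW := hWs x hx Δ' hDm
  have hb2' : (b - b₁) * SC ≤ (wB : ℝ) := (mul_le_mul_of_nonneg_right (by linarith [hb.2]) SC_pos.le).trans hwB
  unfold sCondL at hsc
  simp only [Bool.false_eq_true, ↓reduceIte, Bool.and_eq_true, Bool.or_eq_true, decide_eq_true_eq] at hsc
  obtain ⟨hscHi, hscLo⟩ := hsc
  have hI1r : (0 : ℝ) < (ID1.lo : ℝ) := by exact_mod_cast hI1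
  have hI2r : (0 : ℝ) < (ID2.hi : ℝ) := by exact_mod_cast hI2
  have hsHi : s * SC ≤ (x.sHi : ℝ) := by
    rcases hscHi with h1 | h1
    · have hsle : s ≤ 1 - a₁ / a₂ := by rw [hs]; linarith
      have h1' : (sRg : ℝ) ≤ x.sHi := by exact_mod_cast h1
      have := mul_le_mul_of_nonneg_right hsle SC_pos.le
      linarith
    · have h1r : ((ID2.hi : ℝ) - x.cell.iD.lo) * SC ≤ (x.sHi : ℝ) * ID2.hi := by exact_mod_cast h1
      -- iD.lo ≤ Δ′·SC = μΔ·SC ≤ μΔ₂·SC ≤ μ·ID2.hi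
      have hμI : (x.cell.iD.lo : ℝ) ≤ μ * (ID2.hi : ℝ) := by
        have t1 : (x.cell.iD.lo : ℝ) ≤ Δ' * SC := hDm.1
        have t2 : Δ' * SC ≤ μ * (Δ₂ * SC) := by
          rw [hΔ', mul_assoc]; exact mul_le_mul_of_nonneg_left (mul_le_mul_of_nonneg_right hΔ.2 SC_pos.le) hμ0.le
        have t3 : μ * (Δ₂ * SC) ≤ μ * (ID2.hi : ℝ) := mul_le_mul_of_nonneg_left hD2.2 hμ0.le
        linarith
      have t4 := mul_le_mul_of_nonneg_right hμI SC_pos.le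
      have key : (s * SC) * (ID2.hi : ℝ) ≤ (x.sHi : ℝ) * ID2.hi := by
        have e : (s * SC) * (ID2.hi : ℝ) = SC * ID2.hi - μ * (ID2.hi : ℝ) * SC := by rw [hs]; ring
        have e' : ((ID2.hi : ℝ) - x.cell.iD.lo) * SC = SC * ID2.hi - (x.cell.iD.lo : ℝ) * SC := by ring
        rw [e]; rw [e'] at h1r; linarith
      exact le_of_mul_le_mul_right key hI2r
  have hsLo : (x.sLo : ℝ) ≤ s * SC := by
    rcases hscLo with h1 | h1
    · have h1' : (x.sLo : ℝ) ≤ 0 := by exact_mod_cast h1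
      have : 0 ≤ s * SC := mul_nonneg hs0 SC_pos.le
      linarith
    · have h1r : (SC : ℝ) * x.cell.iD.hi ≤ ((SC : ℝ) - x.sLo) * ID1.lo := by exact_mod_cast h1
      -- μ·ID1.lo ≤ μ·Δ₁·SC ≤ μΔ·SC = Δ′·SC ≤ iD.hi
      have hμI : μ * (ID1.lo : ℝ) ≤ (x.cell.iD.hi : ℝ) := by
        have t1 : μ * (ID1.lo : ℝ) ≤ μ * (Δ₁ * SC) := mul_le_mul_of_nonneg_left hD1.1 hμ0.le
        have t2 : μ * (Δ₁ * SC) ≤ μ * (Δ * SC) := mul_le_mul_of_nonneg_left (mul_le_mul_of_nonneg_right hΔ.1 SC_pos.le) hμ0.le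
        have t3 : μ * (Δ * SC) = Δ' * SC := by rw [hΔ']; ring
        linarith [hDm.2]
      have t4 := mul_le_mul_of_nonneg_right hμI SC_pos.le
      have key : (x.sLo : ℝ) * ID1.lo ≤ (s * SC) * (ID1.lo : ℝ) := by
        have e : (s * SC) * (ID1.lo : ℝ) = SC * ID1.lo - μ * (ID1.lo : ℝ) * SC := by rw [hs]; ring
        have e' : ((SC : ℝ) - x.sLo) * ID1.lo = SC * ID1.lo - (x.sLo : ℝ) * ID1.lo := by ring
        rw [e]; rw [e'] at h1r; linarith
      exact le_of_mul_le_mul_right key hI1r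
  have key := edge_cellL_lower hok hC hA1 hB1 hν0 hν1 hDm hW hb.1 hb2' hs0 hsLo hsHi hs1
  have e0 : a₁ = μ * a := by rw [hμ]; field_simp
  have e1 : b - s * b = μ * b := by rw [hs]; ring
  have e2 : c - s * c = μ * c := by rw [hs]; ring
  have e3 : 1 - s = μ := by rw [hs]; ring
  rw [e0, e1, e2, e3, hΔ', scaleT_fixedFilling_smul hμ0] at key
  exact le_of_mul_le_mul_left key hμ0

end Box

end Summit.Ventures.CertifiedManyBodySolver.Downfold.Emery
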